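/-
Copyright (c) 2026 the pub-hodgecm-mathlib formalisation cell (harness21).  Prover seat hodgecm-mathlib-LH7-p08 (g0) (re-dealt to strike line L3 `stub_N6nsDyadic` by director
s1969 (a)), Track A «(D-RAM) FOUR-FRAME» squad, helper lane on h413 = stmt-HodgeConjecture-24833 (count-neutral).  β-BOARD v1 row R8 ∕ (P5) «H `(2ρ,2ρ,2ρ)`», FILE 3b: the
labelled-odd TABLE VALUE of the core-hanging stratum for the DEEP key `(m, m, L)`, `L − m ≥ 2d`: orbit by orbit over the admissible representatives.  2026-09-04.
-/
import Summits.HodgeConjecture.HodgeConjecture.Theorems.F0P3cDyRamLabelledOddCoreHangingDeepRead        -- (this seat, FILE 3a): `labelledOddCount_div_relIndex_coreHanging_eq_of_deep₃`; brings ★ κH-A2, ★ κH (A1), FILE 2a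
import Summits.HodgeConjecture.HodgeConjecture.Theorems.F0P3cDyRamLabelledOddCoreHangingShell           -- ★ p861362 (this seat, FILE 1): `shell_iff_of_mem_stratum_H`, `finsum_stratum_H_shell_eq_of_eq`
import Summits.HodgeConjecture.HodgeConjecture.Theorems.F0P3cDyRamDiagonalKappaCoreHangingSocket        -- ★ κH-B2 (LH4-p06 (g3)): `finite_orbit`; brings ★ κH-B1 `finsum_chiH_admissible_eq_zero`, ★ B7 (iv) (C) orbit decomposition
import Summits.HodgeConjecture.HodgeConjecture.Theorems.F0P3cDyRamTowerSignToken                       -- ★ p860771∕p860907: the tower-sign token letters (`refSkewScalar_ne_zero`, `v_refSkewScalar`)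
import Summits.HodgeConjecture.HodgeConjecture.Theorems.F0P3cDyRamElementDatumParity                  -- ★ (LH4-p10 (g2)): `isoceles_of_isElementDatum`
import HarnessLib

/-!
# Crux `H413`, line LH4 «(D-RAM) FOUR-FRAME» — (β) table, β-BOARD row R8 ∕ (P5), FILE 3b: «THE H ROW FOR THE DEEP KEY `(m, m, L)`, `L − m ≥ 2d`» —
# `Σᶠ_{M ∈ H(ρ), clean shell} m^Λ_i(M)∕[𝒰 : N S̃(M)] = (0, 0, ω(−1)·ω(e_A))_i ∕ 2 · (q − 2)·q^{2ρ−1}` at `2ρ + ℓ₀ = m` (general `q`; `0` at `q = 2`)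

Cell `hodgecm-mathlib` (D-0151), FLOOR 0, crux item H413 = `stmt-HodgeConjecture-24833`, route `HCCMUnconditional`; squad F0∕P3c∕LH4.  THEOREMS ONLY (no `def`, no instance, no
notation, no `sorry`, default heartbeats); ★-only imports; lane `--supports stmt-HodgeConjecture-24833 --as helper` (count-neutral); pays NO row, states NO law.

THE MATHEMATICS (this seat's H-ROW DERIVATION v1 e4da7f0103cc4a29 §3∕§4, key `(m, m, L)`, DEEP range `s_g = L − m ≥ 2d`; the `(q−2)∕2·S` term of §4 — the term that is INVISIBLE
at `q = 2` and that separates the `…∕4·q^{m−ℓ₀−1}·q^{s∕2}` κ-class rule from the `…∕2·q^{(s−2)∕2}` one, addendum 386f7598 §B).  FILE 3a gives the per-lattice value on every member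
of the orbit of `V_H(1,1,g)`: `w(M)∕2·(ω(g)·ε·ι, ε·ι, ω(−(1+g))·ε)`, `ε = ω(g_α)ω(1+g)`, `ι = [2d−1 ≤ ρ]`, for approximants `g_α = π₀^ρ e_A`, `g_β = π₀^ρ e_B` built from the ★ tower
tokens at the common depth `m = n₁ = n₂` (`(n − ℓ₀)∕2 = ρ`), the DEEP letter `|g_β − g_α| ≤ |ϖ|^{2d−1}|g_α|` being the valuation form of ★ RELATION I (§0: the two tokens differ by
the deep root `β − α`, `|β − α| = |ϖ|^{n₃}`, `n₃ ≥ m + 2d`).  Summing orbit by orbit exactly as ★ κH-B2 `…KappaCoreHangingSocket` (★ B7 (iv) (C) `coreHangingStratum_eq_iUnion_orbits`, ★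
`finsum_stabiliserWeight_orbit_eq`, ★ (iv-c) representatives, ★ (B) `#R_adm`): slot 2 carries the CONSTANT `ω(−1)ω(e_A)∕2` times the ★ tube mass `(q−2)q^{2ρ−1}`; slots 0 and 1 carry
`ι·ω(e_A)ω(−1)·Σ_{g adm} χ^H_{1∕0}(g)·mass∕2 = 0` by ★ κH-B1 `finsum_chiH_admissible_eq_zero` (alive window) or `ι = 0` (dead window).  The clean shell keeps ALL of `H(ρ)` at
`2ρ + ℓ₀ = m` (★ p861362 FILE 1), so the sum over the shell cut is the sum over the stratum.
* §0 `v_towerSign_sub_le_of_sub_deep` — `|e′ − e| ≤ |ϖ|^{2d−1}` for two same-depth tokens whose roots differ deeply (★ p861173's proof, valuation form).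
* §1 `finsum_orbit_labelledOdd_div_relIndex_eq_of_deep₃` — one orbit.
* §2 HEAD `finsum_stratum_H_shell_labelledOdd_div_relIndex_eq_of_deep₃` — the H row, key `(m, m, L)` deep, ★ p860780∕p860897 finsum letters VERBATIM with the H axis.
HONEST LABEL.  Count-neutral (`--supports`); the keys `(m,L,m)`∕`(L,m,m)` (same collapse, slots 1∕0), the boundary key `s_g = 2d−2`, the shallow keys, the equilateral key, `hRest`, (T3),
(β-BAL), (β), T₊ stay OPEN; `HC_CM` is proved only modulo the 7 printed citations (2 remaining named inputs: hLiu418 = `stmt-HodgeConjecture-24832`, h413 = `stmt-HodgeConjecture-24833`)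
until rung 0 closes.

## References
* [Kottwitz1986BaseChangeUnits] R. E. Kottwitz, *Base change for unit elements of Hecke algebras*, Compositio Math. 60 (1986), §1 pp. 240–241 (signed lattice counts modulo the torus).
* [LanglandsShelstad1987] R. P. Langlands, D. Shelstad, *On the definition of transfer factors*, Math. Ann. 278 (1987), §3.
* [Rogawski1990] J. D. Rogawski, *Automorphic Representations of Unitary Groups in Three Variables*, Ann. of Math. Stud. 123 (1990), §4.9 Prop. 4.9.1 (a)(b) p. 55, §4.10 p. 58.
* [Serre1979] J.-P. Serre, *Local Fields*, GTM 67 (1979), Ch. V §3 Cor. 3, Ch. XV §2.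
-/

set_option autoImplicit false

noncomputable section

namespace Summit.HodgeConjecture.HodgeConjecture.Cruxes.H413.F0P3cDyRamLabelledOddCoreHangingDeepSum

open Matrix WithZero
open Literature.NumberTheory.Automorphic Literature.NumberTheory.Automorphic.HermitianLattice Literature.NumberTheory.Automorphic.UnitaryGroup
open Literature.NumberTheory.Automorphic.UnitaryLatticeTree Literature.NumberTheory.Automorphic.UnitaryThreeFourFrame
open Literature.NumberTheory.LocalFields Literature.NumberTheory.LocalFields.WildQuadraticDatum
open Summit.HodgeConjecture.HodgeConjecture.Cruxes.H413.F0P3cDyRamFourFramePieces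
open Summit.HodgeConjecture.HodgeConjecture.Cruxes.H413.F0P3cDyRamFourFrameCensusDefs
open Summit.HodgeConjecture.HodgeConjecture.Cruxes.H413.F0P3cDyRamStageOneBDefs
open Summit.HodgeConjecture.HodgeConjecture.Cruxes.H413.F0P3cDyRamDiagonalTorusDefs
open Summit.HodgeConjecture.HodgeConjecture.Cruxes.H413.F0P3cDyRamDiagonalStrataDefs
open Summit.HodgeConjecture.HodgeConjecture.Cruxes.H413.F0P3cDyRamLabelledOddCountDefs
open Summit.HodgeConjecture.HodgeConjecture.Cruxes.H413.F0P3cDyRamLabelledOddCoreHangingDeepRead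
open Summit.HodgeConjecture.HodgeConjecture.Cruxes.H413.F0P3cDyRamLabelledOddCoreHangingShell (shell_iff_of_mem_stratum_H finsum_stratum_H_shell_eq_of_eq)
open Summit.HodgeConjecture.HodgeConjecture.Cruxes.H413.F0P3cDyRamDiagonalCoreHangingSocket (stratum_H_eq)
open Summit.HodgeConjecture.HodgeConjecture.Cruxes.H413.F0P3cDyRamDiagonalCoreHangingCount (coreHangingStratum_eq_iUnion_orbits pairwise_disjoint_orbits finsum_stabiliserWeight_orbit_eq)
open Summit.HodgeConjecture.HodgeConjecture.Cruxes.H413.F0P3cDyRamDiagonalCoreHangingOrbits (exists_coreHanging_of_mem_orbit)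
open Summit.HodgeConjecture.HodgeConjecture.Cruxes.H413.F0P3cDyRamDiagonalCoreHangingClasses (ncard_admissible_representatives_eq)
open Summit.HodgeConjecture.HodgeConjecture.Cruxes.H413.F0P3cDyRamDiagonalGluedTorusOrbits (exists_gl_coe_eq_glued)
open Summit.HodgeConjecture.HodgeConjecture.Cruxes.H413.F0P3cDyRamDiagonalGluedClassRepresentatives (exists_fixed_class_representatives)
open Summit.HodgeConjecture.HodgeConjecture.Cruxes.H413.F0P3cDyRamDiagonalGluedStabiliserIndex (ne_zero_and_v_lt_one_of_v_eq_exp)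
open Summit.HodgeConjecture.HodgeConjecture.Cruxes.H413.F0P3cDyRamDiagonalKappaCoreHangingSocket (finite_orbit)
open Summit.HodgeConjecture.HodgeConjecture.Cruxes.H413.F0P3cDyRamDiagonalKappaCoreHangingCharacterSums (finsum_chiH_admissible_eq_zero)
open Summit.HodgeConjecture.HodgeConjecture.Cruxes.H413.F0P3cDyRamDiagonalCoreHangingPolarisationExplicit (normSign_mul_norm')
open Summit.HodgeConjecture.HodgeConjecture.Cruxes.H413.F0P3cDyRamStableCountTypeZero (v_diag_eq_one)
open Summit.HodgeConjecture.HodgeConjecture.Cruxes.H413.F0P3cDyRamDiagonalStratumTools (finsum_mem_eq_ncard_mul)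
open Summit.HodgeConjecture.HodgeConjecture.Cruxes.H413.F0P3cDyRamDiagonalKappaCoreHangingClass (two_le_d_of_v_two_lt_one)
open scoped Valued WithZero Matrix MatrixGroups

variable {K : Type} [Field K] [Valued K ℤᵐ⁰]

/-! ## §0  Two same-depth tokens whose roots differ deeply are `𝔭^{2d−1}`-close (valuation form of ★ RELATION I) -/

/-- **`|e′ − e| ≤ |ϖ|^{2d−1}`** for tower-sign tokens `e` of `α − 1` and `e′` of `β − 1` at the same depth parameter `n ≡ d (mod 2)` when `|β − α| ≤ |ϖ|^L`, `n + 2d ≤ L + 1` — ★ p861173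
`normSign_towerSign_eq_of_sub_deep`'s proof up to its last line (there the conclusion `ω(e′) = ω(e)` was drawn; here the valuation letter itself is exported, as FILE 3a's `hnear`).
[cite: Serre1979, Ch. V §3] [cite: Rogawski1990, §4.9 p. 55] -/
theorem v_towerSign_sub_le_of_sub_deep {σ : K →+* K} {ϖ : K} {d t : ℕ} (hD : IsRamifiedQuadraticDatum σ ϖ d t)
    {α β : K} {n L : ℕ} (hvβα : Valued.v (β - α) ≤ Valued.v ϖ ^ L) (hL : n + 2 * d ≤ L + 1) (hpar : n % 2 = d % 2)
    {e e' : K}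
    (he : Valued.v ((ϖ ^ mstarOfRecord d)⁻¹ * ((α - 1) * ((ϖ * σ ϖ) ^ ((n - d % 2) / 2))⁻¹ - e * ((ϖ - σ ϖ) * ((ϖ * σ ϖ) ^ ((d - d % 2) / 2))⁻¹))) ≤ 1)
    (he' : Valued.v ((ϖ ^ mstarOfRecord d)⁻¹ * ((β - 1) * ((ϖ * σ ϖ) ^ ((n - d % 2) / 2))⁻¹ - e' * ((ϖ - σ ϖ) * ((ϖ * σ ϖ) ^ ((d - d % 2) / 2))⁻¹))) ≤ 1) :
    Valued.v (e - e') ≤ Valued.v ϖ ^ (2 * d - 1) := by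
  obtain ⟨hσ, hvσ, hϖ, -, hd, h1d, -⟩ := id hD
  have hϖ0 : ϖ ≠ 0 := fun h => by rw [h, map_zero] at hϖ; exact (coe_ne_zero hϖ.symm).elim
  have hvϖ0 : Valued.v ϖ ≠ 0 := (Valuation.ne_zero_iff _).2 hϖ0
  obtain ⟨k, hnk⟩ : ∃ k : ℕ, n = 2 * k + d % 2 := ⟨n / 2, by omega⟩
  have hk : (n - d % 2) / 2 = k := by omega
  rw [hk] at he he'
  set P : K := ((ϖ * σ ϖ) ^ k)⁻¹ with hPdef
  set tp : K := (ϖ - σ ϖ) * ((ϖ * σ ϖ) ^ ((d - d % 2) / 2))⁻¹ with htpdef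
  set M : K := (ϖ ^ mstarOfRecord d)⁻¹ with hMdef
  have hvtp : Valued.v tp = Valued.v ϖ ^ (d % 2) := by rw [htpdef, v_refSkewScalar hvσ hϖ hd, v_varpi_pow hϖ]
  have hvP : Valued.v P = (Valued.v ϖ ^ (2 * k))⁻¹ := by rw [hPdef, map_inv₀, map_pow, map_mul, hvσ, ← pow_two, ← pow_mul]
  have hvM : Valued.v M = (Valued.v ϖ ^ mstarOfRecord d)⁻¹ := by rw [hMdef, map_inv₀, map_pow]
  have hid : M * ((e - e') * tp) = -(M * ((α - 1) * P - e * tp)) + M * ((β - 1) * P - e' * tp) - M * ((β - α) * P) := by ring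
  have h3 : Valued.v (M * ((β - α) * P)) ≤ Valued.v ϖ ^ (2 * d - 1 + d % 2) * (Valued.v ϖ ^ mstarOfRecord d)⁻¹ := by
    rw [map_mul, map_mul, hvM, hvP, mul_comm]
    have hL' : 2 * d - 1 + d % 2 + 2 * k ≤ L := by omega
    have hpow : Valued.v ϖ ^ L ≤ Valued.v ϖ ^ (2 * d - 1 + d % 2 + 2 * k) :=
      pow_le_pow_right_of_le_one' (le_of_lt (by rw [hϖ, ← exp_zero, exp_lt_exp]; norm_num)) hL'
    have hβα' : Valued.v (β - α) * (Valued.v ϖ ^ (2 * k))⁻¹ ≤ Valued.v ϖ ^ (2 * d - 1 + d % 2) := by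
      rw [mul_inv_le_iff₀ (pow_pos ((Valuation.pos_iff _).2 hϖ0) _), ← pow_add]
      exact hvβα.trans hpow
    exact mul_le_mul' hβα' le_rfl
  have h12 : Valued.v (-(M * ((α - 1) * P - e * tp)) + M * ((β - 1) * P - e' * tp)) ≤ 1 := by
    refine (Valuation.map_add _ _ _).trans (max_le ?_ he')
    rw [Valuation.map_neg]; exact he
  have hm : 2 * d - 1 + d % 2 = mstarOfRecord d := by unfold mstarOfRecord; omega
  have h3' : Valued.v (M * ((β - α) * P)) ≤ 1 := by
    refine h3.trans ?_
    rw [hm, mul_inv_cancel₀ (pow_ne_zero _ hvϖ0)]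
  have htot : Valued.v (M * ((e - e') * tp)) ≤ 1 := by
    rw [hid]
    exact (Valuation.map_sub _ _ _).trans (max_le h12 h3')
  rw [map_mul, map_mul, hvM, hvtp] at htot
  have hpos : 0 < (Valued.v ϖ ^ mstarOfRecord d)⁻¹ := inv_pos.2 (pow_pos ((Valuation.pos_iff _).2 hϖ0) _)
  rw [mul_comm ((Valued.v ϖ ^ mstarOfRecord d)⁻¹), ← le_div_iff₀ hpos, div_inv_eq_mul, one_mul] at htot
  have hm' : mstarOfRecord d = (2 * d - 1) + d % 2 := by unfold mstarOfRecord; omega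
  rw [hm', pow_add] at htot
  exact le_of_mul_le_mul_right htot (pow_pos ((Valuation.pos_iff _).2 hϖ0) _)

/-! ## §1  One orbit: the per-lattice value is constant by value along `𝒯·latt V_H(1,1,g)` -/

/-- **THE LABELLED-ODD MASS OF ONE CORE-HANGING ORBIT, DEEP KEY `(m, m, L)`.**  For a fixed unit `g` with `|1 + g| = 1`, every member of the unit-torus orbit of `V_H(1,1,g)` is a core-hanging
lattice `latt(1 0 0; x′ ϖ^ρ 0; x′ζ′ + g·x′ζ′ ϖ^ρζ′ ϖ^{2ρ})` with the EXACT invariant `g` (★ (A) `exists_coreHanging_of_mem_orbit`), so FILE 3a gives its value `w(M)∕2·vec(g)_i` on the whole orbit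
(the 𝓛₀(T)-membership and the shell tokens of the members being supplied by `horb`), and `Σᶠ_{orbit} = vec(g)_i∕2 · Σᶠ_{orbit} w`, the second factor being ★ (C) `finsum_stabiliserWeight_orbit_eq`.
[cite: Kottwitz1986BaseChangeUnits, §1 pp. 240–241] [cite: LanglandsShelstad1987, §3] -/
theorem finsum_orbit_labelledOdd_div_relIndex_eq_of_deep₃ [CompleteSpace K] [Finite 𝓀[K]] {σ : K →+* K} {ϖ : K} {d t : ℕ}
    (hD : IsRamifiedQuadraticDatum σ ϖ d t) (h2 : Valued.v (2 : K) < 1) {ρ : ℕ} (hρ : 1 ≤ ρ) (h2ρ : 2 * d - 1 ≤ 2 * ρ)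
    {g : K} (hσg : σ g = g) (hvg : Valued.v g = 1) (h1g : Valued.v (1 + g) = 1)
    {α β : K} {N₀ n₁ n₂ n₃ : ℕ} (hE : IsElementDatum σ ϖ N₀ α β n₁ n₂ n₃) {mc : ℕ} (hℓN : d % 2 + 1 ≤ N₀) (hmN : d % 2 + 2 * d - 1 ≤ N₀)
    (hℓmc : 2 * (d % 2) + 1 ≤ mc) (hmmc : d % 2 + 2 * d - 1 + d % 2 ≤ mc)
    {T : GL (Fin 3) K} (hT : (T : Matrix (Fin 3) (Fin 3) K) = Matrix.diagonal ![α, β, 1])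
    (horb : ∀ M ∈ {M : Submodule 𝒪[K] (Fin 3 → K) | ∃ u ∈ unitTorus K 3,
        M = mapGL (diagGLUnits u) (latt (!![1, 0, 0; 1, ϖ ^ ρ, 0; 1 * 1 + g, ϖ ^ ρ * 1, ϖ ^ (2 * ρ)] : Matrix (Fin 3) (Fin 3) K))},
      M ∈ normalisedStableLattices T ∧
        LatticeInLevel ϖ (d % 2) (Matrix.diagonal ![α - 1, β - 1, 0]) M ∧ ¬ LatticeInLevel ϖ (d % 2 + 1) (Matrix.diagonal ![α - 1, β - 1, 0]) M ∧
          LatticeInLevel ϖ mc (Matrix.diagonal ![(α - 1) * (α - 1), (β - 1) * (β - 1), 0]) M)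
    {gα gβ : K} (hσgα : σ gα = gα) (hσgβ : σ gβ = gβ) (hgα0 : gα ≠ 0)
    (hgα : Valued.v ((ϖ ^ (d % 2 + 2 * d - 1))⁻¹ * (((ϖ * σ ϖ) ^ ρ)⁻¹ * ((α - 1) - gα * ((ϖ - σ ϖ) * ((ϖ * σ ϖ) ^ ((d - d % 2) / 2))⁻¹)))) ≤ 1)
    (hgβ : Valued.v ((ϖ ^ (d % 2 + 2 * d - 1))⁻¹ * (((ϖ * σ ϖ) ^ ρ)⁻¹ * ((β - 1) - gβ * ((ϖ - σ ϖ) * ((ϖ * σ ϖ) ^ ((d - d % 2) / 2))⁻¹)))) ≤ 1)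
    (hnear : Valued.v (gβ - gα) ≤ Valued.v ϖ ^ (2 * d - 1) * Valued.v gα) (i : Fin 3) :
    ∑ᶠ M ∈ {M : Submodule 𝒪[K] (Fin 3 → K) | ∃ u ∈ unitTorus K 3, M = mapGL (diagGLUnits u) (latt (!![1, 0, 0; 1, ϖ ^ ρ, 0; 1 * 1 + g, ϖ ^ ρ * 1, ϖ ^ (2 * ρ)] : Matrix (Fin 3) (Fin 3) K))},
        (labelledOddCount σ ϖ 0 i (valueClassLabel σ ϖ (α - 1) (β - 1) (d % 2 + 2 * d - 1) d) M : ℚ) /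
          ((((unitStabilizer M).map (unitNormMap σ 3)).relIndex (fixedUnitTorus σ 3) : ℕ) : ℚ) =
      (((![normSign σ g * (normSign σ gα * normSign σ (1 + g)) * (if 2 * d - 1 ≤ ρ then 1 else 0),
           normSign σ gα * normSign σ (1 + g) * (if 2 * d - 1 ≤ ρ then 1 else 0),
           normSign σ (-(1 + g)) * (normSign σ gα * normSign σ (1 + g))] : Fin 3 → ℤ) i : ℤ) : ℚ) / 2 *
        (((((Nat.card 𝓀[K] - 1) * Nat.card 𝓀[K] ^ (ρ - 1)) * ((Nat.card 𝓀[K] - 1) * Nat.card 𝓀[K] ^ (2 * ρ - 1)) : ℕ) : ℚ) *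
          ((((Nat.card 𝓀[K] - 1) * Nat.card 𝓀[K] ^ ((ρ + 1) / 2 - 1)) * ((Nat.card 𝓀[K] - 1) * Nat.card 𝓀[K] ^ (ρ - 1)) : ℕ) : ℚ)⁻¹) := by
  obtain ⟨hσ, hvσ, hϖ, hfix, hd, -, -⟩ := id hD
  obtain ⟨hϖ0, -⟩ := ne_zero_and_v_lt_one_of_v_eq_exp hϖ
  -- the value is constant on the orbit, by value (FILE 3a on every member)
  have hconst : ∀ M ∈ {M : Submodule 𝒪[K] (Fin 3 → K) | ∃ u ∈ unitTorus K 3,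
        M = mapGL (diagGLUnits u) (latt (!![1, 0, 0; 1, ϖ ^ ρ, 0; 1 * 1 + g, ϖ ^ ρ * 1, ϖ ^ (2 * ρ)] : Matrix (Fin 3) (Fin 3) K))},
      (labelledOddCount σ ϖ 0 i (valueClassLabel σ ϖ (α - 1) (β - 1) (d % 2 + 2 * d - 1) d) M : ℚ) /
          ((((unitStabilizer M).map (unitNormMap σ 3)).relIndex (fixedUnitTorus σ 3) : ℕ) : ℚ) =
        (((![normSign σ g * (normSign σ gα * normSign σ (1 + g)) * (if 2 * d - 1 ≤ ρ then 1 else 0),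
             normSign σ gα * normSign σ (1 + g) * (if 2 * d - 1 ≤ ρ then 1 else 0),
             normSign σ (-(1 + g)) * (normSign σ gα * normSign σ (1 + g))] : Fin 3 → ℤ) i : ℤ) : ℚ) / 2 * stabiliserWeight σ M := by
    intro M hM
    obtain ⟨hM0, hlev, hnlev, hsq⟩ := horb M hM
    obtain ⟨u, hu, rfl⟩ := hM
    obtain ⟨V₀, hV₀⟩ := exists_gl_coe_eq_glued (1 : K) 1 g (pow_ne_zero ρ hϖ0) (pow_ne_zero (2 * ρ) hϖ0)
    obtain ⟨x', ζ', y₁, hx', hζ', -, -, hκ, hMe⟩ := exists_coreHanging_of_mem_orbit u hu hvg h1g (ϖ ^ ρ) (ϖ ^ (2 * ρ)) V₀ hV₀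
    have hx0 : x' ≠ 0 := fun h0 => by rw [h0, map_zero] at hx'; exact zero_ne_one hx'
    have hζ0 : ζ' ≠ 0 := fun h0 => by rw [h0, map_zero] at hζ'; exact zero_ne_one hζ'
    have hy₁ : y₁ = g * (x' * ζ') := by rw [← hκ]; field_simp
    obtain ⟨V, hV⟩ := exists_gl_coe_eq_glued x' ζ' (g * (x' * ζ')) (pow_ne_zero ρ hϖ0) (pow_ne_zero (2 * ρ) hϖ0)
    rw [← hV₀] at hM0 hlev hnlev hsq ⊢
    rw [hMe, hy₁, ← hV] at hM0 hlev hnlev hsq ⊢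
    rw [labelledOddCount_div_relIndex_coreHanging_eq_of_deep₃ hD h2 hρ h2ρ hx' hζ' hσg hvg h1g V hV hE hℓN hmN hℓmc hmmc hT hM0 hlev hnlev hsq
      hσgα hσgβ hgα0 hgα hgβ hnear i]
    ring
  rw [finsum_mem_congr rfl hconst, ← mul_finsum_mem, finsum_stabiliserWeight_orbit_eq hσ hvσ hfix hϖ hd hρ hσg hvg]

/-! ## §2  HEAD — the H row for the deep key `(m, m, L)` -/

/-- **THE H ROW, DEEP KEY `(m, m, L)` (`n₁ = n₂ = m`, `m + 2d ≤ n₃`), AT `2ρ + ℓ₀ = m`.**  Ramified datum on a complete field with finite residue field `q = #𝓀`, `|2| < 1`; element datum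
with `mcOfRecord d ≤ N₀`; `T = diag(α, β, 1)`; tower-sign tokens `e_A` of `α − 1` (depth `n₂`) and `e_B` of `β − 1` (depth `n₁`) — ★ p860780's `heA`∕`heB` VERBATIM.  Then for every slot `i`
`Σᶠ_{M ∈ stratum σ ϖ T (2ρ,2ρ,2ρ), clean shell} labelledOddCount σ ϖ 0 i Λ M ∕ [𝒰 : N(S̃′(M))] = (0, 0, ω(−1)·ω(e_A))_i ∕ 2 · (q − 2)·q^{2ρ−1}`
(`Λ = valueClassLabel σ ϖ (α−1) (β−1) m* d`): the special slot `2` carries `(q−2)∕2 · ω(−1)ω(e_A)·q^{m−ℓ₀−1}` — the `(q−2)∕2·S` of the H-ROW DERIVATION (`S = (σ₁[2]+σ₂[2])∕2·q^{m−ℓ₀−1}`,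
`σ₁[2] = σ₂[2] = ω(−1)ω(e_A)` by ★ RELATION I) — and the other two slots vanish (★ κH-B1's admissible character sums in the alive window, the dead indicator otherwise).
[cite: Kottwitz1986BaseChangeUnits, §1 pp. 240–241] [cite: LanglandsShelstad1987, §3] [cite: Rogawski1990, §4.9 Prop. 4.9.1 (a)(b) p. 55, §4.10 p. 58] -/
theorem finsum_stratum_H_shell_labelledOdd_div_relIndex_eq_of_deep₃ [CompleteSpace K] [Finite 𝓀[K]] {σ : K →+* K} {ϖ : K} {d t : ℕ}
    (hD : IsRamifiedQuadraticDatum σ ϖ d t) (h2 : Valued.v (2 : K) < 1)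
    {α β : K} {N₀ n₁ n₂ n₃ : ℕ} (hE : IsElementDatum σ ϖ N₀ α β n₁ n₂ n₃) (hmc : mcOfRecord d ≤ N₀) (h12 : n₁ = n₂) (hdeep : n₁ + 2 * d ≤ n₃)
    (T : GL (Fin 3) K) (hT : (T : Matrix (Fin 3) (Fin 3) K) = Matrix.diagonal ![α, β, 1]) (ρ : ℕ) (hρ : 1 ≤ ρ) (h2ρ : 2 * ρ + d % 2 = n₁)
    {eA eB : K} (hσeA : σ eA = eA) (heA1 : Valued.v eA = 1) (hσeB : σ eB = eB)
    (heA : Valued.v ((ϖ ^ mstarOfRecord d)⁻¹ * ((α - 1) * ((ϖ * σ ϖ) ^ ((n₂ - d % 2) / 2))⁻¹ - eA * ((ϖ - σ ϖ) * ((ϖ * σ ϖ) ^ ((d - d % 2) / 2))⁻¹))) ≤ 1)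
    (heB : Valued.v ((ϖ ^ mstarOfRecord d)⁻¹ * ((β - 1) * ((ϖ * σ ϖ) ^ ((n₁ - d % 2) / 2))⁻¹ - eB * ((ϖ - σ ϖ) * ((ϖ * σ ϖ) ^ ((d - d % 2) / 2))⁻¹))) ≤ 1)
    (i : Fin 3) :
    ∑ᶠ M ∈ {M : Submodule 𝒪[K] (Fin 3 → K) | M ∈ stratum σ ϖ T ![2 * ρ, 2 * ρ, 2 * ρ] ∧
        (LatticeInLevel ϖ (d % 2) (Matrix.diagonal ![α - 1, β - 1, 0]) M ∧ ¬ LatticeInLevel ϖ (d % 2 + 1) (Matrix.diagonal ![α - 1, β - 1, 0]) M ∧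
          LatticeInLevel ϖ (mcOfRecord d) (Matrix.diagonal ![(α - 1) * (α - 1), (β - 1) * (β - 1), 0]) M)},
      (labelledOddCount σ ϖ 0 i (valueClassLabel σ ϖ (α - 1) (β - 1) (mstarOfRecord d) d) M : ℚ) /
        ((((unitStabilizer M).map (unitNormMap σ 3)).relIndex (fixedUnitTorus σ 3) : ℕ) : ℚ) =
      (((![0, 0, normSign σ (-1 : K) * normSign σ eA] : Fin 3 → ℤ) i : ℤ) : ℚ) / 2 * (((Nat.card 𝓀[K] : ℚ) - 2) * (Nat.card 𝓀[K] : ℚ) ^ (2 * ρ - 1)) := by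
  classical
  have hTr := trace_bound_of_isRamifiedQuadraticDatum hD h2
  have hiso := F0P3cDyRamElementDatumParity.isoceles_of_isElementDatum hD hE
  obtain ⟨hσ, hvσ, hϖ, hfix, hd, hd1, -⟩ := id hD
  obtain ⟨hϖ0, hϖ1⟩ := ne_zero_and_v_lt_one_of_v_eq_exp hϖ
  have hq : 1 < Nat.card 𝓀[K] := Finite.one_lt_card
  have h2d : 2 ≤ d := two_le_d_of_v_two_lt_one hD h2
  have hσϖ0 : σ ϖ ≠ 0 := (map_ne_zero σ).2 hϖ0
  have hπ0 : ((ϖ * σ ϖ) ^ ρ : K) ≠ 0 := pow_ne_zero _ (mul_ne_zero hϖ0 hσϖ0)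
  -- element letters
  have hα1 : Valued.v α = 1 := (v_diag_eq_one hvσ hE) 0
  have hβ1 : Valued.v β = 1 := (v_diag_eq_one hvσ hE) 1
  have h₁ : Valued.v (β - 1) = Valued.v ϖ ^ n₁ := hE.2.2.2.2.2.1
  have h₂ : Valued.v (α - 1) = Valued.v ϖ ^ n₂ := hE.2.2.2.2.2.2.1
  have h₃ : Valued.v (β - α) = Valued.v ϖ ^ n₃ := by rw [Valuation.map_sub_swap]; exact hE.2.2.2.2.2.2.2.1
  have hn₁ : N₀ ≤ n₁ := hE.2.2.2.2.2.2.2.2.1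
  -- numerics of the letters
  have hmcv : mcOfRecord d = 2 * ((d % 2 + 2 * d - 1 + d) / 2) := rfl
  have hmsv : mstarOfRecord d = d % 2 + 2 * d - 1 := rfl
  have hℓN : d % 2 + 1 ≤ N₀ := by rw [hmcv] at hmc; omega
  have hmN : d % 2 + 2 * d - 1 ≤ N₀ := by rw [hmcv] at hmc; omega
  have hℓmc : 2 * (d % 2) + 1 ≤ mcOfRecord d := by rw [hmcv]; omega
  have hmmc : d % 2 + 2 * d - 1 + d % 2 ≤ mcOfRecord d := by rw [hmcv]; omega
  have hneq : ¬ (n₁ = n₂ ∧ n₂ = n₃) := fun h => by omega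
  have h2ρmin : 2 * ρ + d % 2 = min n₁ n₂ := by omega
  have h2ρ' : 2 * d - 1 ≤ 2 * ρ := by omega
  have hρ₁ : 2 * ρ ≤ n₁ := by omega
  have hρ₂ : 2 * ρ ≤ n₂ := by omega
  have hρ₃ : ρ ≤ n₃ := by omega
  have hkα : (n₂ - d % 2) / 2 = ρ := by omega
  have hkβ : (n₁ - d % 2) / 2 = ρ := by omega
  -- the DEEP letter (§0) from the tokens as given: `|e_A − e_B| ≤ |ϖ|^{2d−1}`
  have hpar : n₂ % 2 = d % 2 := by omega
  have heB' : Valued.v ((ϖ ^ mstarOfRecord d)⁻¹ * ((β - 1) * ((ϖ * σ ϖ) ^ ((n₂ - d % 2) / 2))⁻¹ - eB * ((ϖ - σ ϖ) * ((ϖ * σ ϖ) ^ ((d - d % 2) / 2))⁻¹))) ≤ 1 := by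
    rw [← h12]; exact heB
  have hnearE : Valued.v (eA - eB) ≤ Valued.v ϖ ^ (2 * d - 1) :=
    v_towerSign_sub_le_of_sub_deep hD (L := n₃) (le_of_eq h₃) (by omega) hpar heA heB'
  rw [hkα] at heA
  rw [hkβ] at heB
  -- the approximants `g_α = π₀^ρ e_A`, `g_β = π₀^ρ e_B` and FILE 3a's letters for them
  have hσπ : σ ((ϖ * σ ϖ) ^ ρ) = (ϖ * σ ϖ) ^ ρ := by rw [map_pow, map_mul, hσ, mul_comm]
  have hσgα : σ ((ϖ * σ ϖ) ^ ρ * eA) = (ϖ * σ ϖ) ^ ρ * eA := by rw [map_mul, hσπ, hσeA]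
  have hσgβ : σ ((ϖ * σ ϖ) ^ ρ * eB) = (ϖ * σ ϖ) ^ ρ * eB := by rw [map_mul, hσπ, hσeB]
  have heA0 : eA ≠ 0 := fun h => by rw [h, map_zero] at heA1; exact zero_ne_one heA1
  have hgα0 : (ϖ * σ ϖ) ^ ρ * eA ≠ 0 := mul_ne_zero hπ0 heA0
  have hrew : ∀ x e : K, ((ϖ * σ ϖ) ^ ρ)⁻¹ * (x - (ϖ * σ ϖ) ^ ρ * e * ((ϖ - σ ϖ) * ((ϖ * σ ϖ) ^ ((d - d % 2) / 2))⁻¹)) =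
      x * ((ϖ * σ ϖ) ^ ρ)⁻¹ - e * ((ϖ - σ ϖ) * ((ϖ * σ ϖ) ^ ((d - d % 2) / 2))⁻¹) := fun x e => by field_simp
  have hgα : Valued.v ((ϖ ^ (d % 2 + 2 * d - 1))⁻¹ * (((ϖ * σ ϖ) ^ ρ)⁻¹ * ((α - 1) - (ϖ * σ ϖ) ^ ρ * eA * ((ϖ - σ ϖ) * ((ϖ * σ ϖ) ^ ((d - d % 2) / 2))⁻¹)))) ≤ 1 := by
    rw [hrew, ← hmsv]; exact heA
  have hgβ : Valued.v ((ϖ ^ (d % 2 + 2 * d - 1))⁻¹ * (((ϖ * σ ϖ) ^ ρ)⁻¹ * ((β - 1) - (ϖ * σ ϖ) ^ ρ * eB * ((ϖ - σ ϖ) * ((ϖ * σ ϖ) ^ ((d - d % 2) / 2))⁻¹)))) ≤ 1 := by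
    rw [hrew, ← hmsv]; exact heB
  -- hence `|g_β − g_α| ≤ |ϖ|^{2d−1}·|g_α|`
  have hnear : Valued.v ((ϖ * σ ϖ) ^ ρ * eB - (ϖ * σ ϖ) ^ ρ * eA) ≤ Valued.v ϖ ^ (2 * d - 1) * Valued.v ((ϖ * σ ϖ) ^ ρ * eA) := by
    rw [← mul_sub, map_mul, map_mul, heA1, mul_one, mul_comm, Valuation.map_sub_swap]
    exact mul_le_mul' hnearE le_rfl
  -- `ω(g_α) = ω(e_A)`
  have hωgα : normSign σ ((ϖ * σ ϖ) ^ ρ * eA) = normSign σ eA := by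
    rw [show (ϖ * σ ϖ) ^ ρ * eA = ϖ ^ ρ * σ (ϖ ^ ρ) * eA by rw [map_pow, ← mul_pow]]
    exact normSign_mul_norm' σ eA (pow_ne_zero _ hϖ0)
  -- the shell keeps the whole stratum (FILE 1), the stratum is the frame set (★ B7), decomposed into orbits (★ (C))
  rw [finsum_stratum_H_shell_eq_of_eq hD hE hmc hneq T ρ hρ h2ρmin, stratum_H_eq hvσ hfix hϖ T hρ, hmsv]
  obtain ⟨R, hRfin, hRcard, hR1, hR2, hR3⟩ := exists_fixed_class_representatives hσ hvσ hfix hϖ hd ρ 0 hρ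
  simp only [Nat.mul_zero, pow_zero, Nat.add_zero] at hR1 hR2 hR3
  have hadm := ncard_admissible_representatives_eq hσ hvσ hfix hϖ hd hρ hRfin hRcard hR1 hR2 hR3
  have hRadmfin : {g : K | g ∈ R ∧ Valued.v (1 + g) = 1}.Finite := hRfin.subset (Set.sep_subset _ _)
  have hunion := coreHangingStratum_eq_iUnion_orbits hσ hvσ hϖ hTr T hT hα1 hβ1 h₁ h₂ h₃ hρ hρ₁ hρ₂ hρ₃ hR1 hR2
  -- every orbit member is in the stratum: 𝓛₀(T)-membership and the shell tokens (FILE 1)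
  have horb : ∀ g ∈ {g : K | g ∈ R ∧ Valued.v (1 + g) = 1}, ∀ M ∈ {M : Submodule 𝒪[K] (Fin 3 → K) | ∃ u ∈ unitTorus K 3,
        M = mapGL (diagGLUnits u) (latt (!![1, 0, 0; 1, ϖ ^ ρ, 0; 1 * 1 + g, ϖ ^ ρ * 1, ϖ ^ (2 * ρ)] : Matrix (Fin 3) (Fin 3) K))},
      M ∈ normalisedStableLattices T ∧
        LatticeInLevel ϖ (d % 2) (Matrix.diagonal ![α - 1, β - 1, 0]) M ∧ ¬ LatticeInLevel ϖ (d % 2 + 1) (Matrix.diagonal ![α - 1, β - 1, 0]) M ∧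
          LatticeInLevel ϖ (mcOfRecord d) (Matrix.diagonal ![(α - 1) * (α - 1), (β - 1) * (β - 1), 0]) M := by
    intro g hg M hM
    have hframe : M ∈ {M : Submodule 𝒪[K] (Fin 3 → K) | M ∈ normalisedStableLattices T ∧ IsDualisableLattice σ ϖ M ∧
        ∃ x ζ y'' : K, Valued.v x = 1 ∧ Valued.v ζ = 1 ∧ Valued.v y'' = 1 ∧ Valued.v (x * ζ + y'') = 1 ∧
          M = latt (!![1, 0, 0; x, ϖ ^ ρ, 0; x * ζ + y'', ϖ ^ ρ * ζ, ϖ ^ (2 * ρ)] : Matrix (Fin 3) (Fin 3) K)} := by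
      rw [hunion]; exact Set.mem_biUnion hg hM
    have hstr : M ∈ stratum σ ϖ T ![2 * ρ, 2 * ρ, 2 * ρ] := by rw [stratum_H_eq hvσ hfix hϖ T hρ]; exact hframe
    exact ⟨hframe.1, (shell_iff_of_mem_stratum_H hD hE hmc hneq T hρ M hstr).2 h2ρmin⟩
  rw [hunion, finsum_mem_biUnion (pairwise_disjoint_orbits hϖ ρ (fun g hg => (hR1 g hg).2) hR3) hRadmfin (fun g hg => finite_orbit hϖ hρ (hR1 _ hg.1).2),
    finsum_mem_congr rfl (fun g hg => finsum_orbit_labelledOdd_div_relIndex_eq_of_deep₃ hD h2 hρ h2ρ' (hR1 _ hg.1).1 (hR1 _ hg.1).2 hg.2 hE hℓN hmN hℓmc hmmc hT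
      (horb g hg) hσgα hσgβ hgα0 hgα hgβ hnear i)]
  -- `ω(−(1+g)) = ω(−1)·ω(1+g)` and `ω(g·…)` bookkeeping on the admissible set
  have hωneg : ∀ g ∈ {g : K | g ∈ R ∧ Valued.v (1 + g) = 1}, normSign σ (-(1 + g)) = normSign σ (-1 : K) * normSign σ (1 + g) := fun g hg => by
    have h1g0 : 1 + g ≠ 0 := fun h => by have := hg.2; rw [h, map_zero] at this; exact zero_ne_one this
    rw [← normSign_mul_of_fixed hD (by rw [map_neg, map_one]) (by rw [map_add, map_one, (hR1 _ hg.1).1]) (neg_ne_zero.2 one_ne_zero) h1g0, neg_one_mul]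
  have hsq1 : ∀ x : K, normSign σ x * normSign σ x = 1 := fun x =>
    F0P3cDyRamDiagonalKappaSplitCountEval.normSign_mul_self σ x
  -- the orbit mass (g-independent) and its product with `#R_adm`
  set mass : ℚ := ((((Nat.card 𝓀[K] - 1) * Nat.card 𝓀[K] ^ (ρ - 1)) * ((Nat.card 𝓀[K] - 1) * Nat.card 𝓀[K] ^ (2 * ρ - 1)) : ℕ) : ℚ) *
    ((((Nat.card 𝓀[K] - 1) * Nat.card 𝓀[K] ^ ((ρ + 1) / 2 - 1)) * ((Nat.card 𝓀[K] - 1) * Nat.card 𝓀[K] ^ (ρ - 1)) : ℕ) : ℚ)⁻¹ with hmass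
  have htube : ({g : K | g ∈ R ∧ Valued.v (1 + g) = 1}.ncard : ℚ) * mass = ((Nat.card 𝓀[K] : ℚ) - 2) * (Nat.card 𝓀[K] : ℚ) ^ (2 * ρ - 1) := by
    rw [hadm, hmass]
    have hq1 : ((Nat.card 𝓀[K] : ℚ) - 1) ≠ 0 := by
      have : (1 : ℚ) < Nat.card 𝓀[K] := by exact_mod_cast hq
      linarith
    have hq0 : (Nat.card 𝓀[K] : ℚ) ≠ 0 := by exact_mod_cast (by omega : Nat.card 𝓀[K] ≠ 0)
    have e2 : 2 * ρ - 1 = ρ + (ρ - 1) := by omega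
    push_cast [Nat.cast_sub hq.le, Nat.cast_sub (show 2 ≤ Nat.card 𝓀[K] by omega)]
    rw [e2, pow_add]
    field_simp
  clear_value mass
  fin_cases i
  · -- slot 0: `ι·ω(e_A)ω(−1)·Σ_g χ₁^H(g)·mass∕2 = 0`
    simp only [Fin.zero_eta]
    by_cases hal : 2 * d - 1 ≤ ρ
    · have hterm : ∀ g ∈ {g : K | g ∈ R ∧ Valued.v (1 + g) = 1},
          (((![normSign σ g * (normSign σ ((ϖ * σ ϖ) ^ ρ * eA) * normSign σ (1 + g)) * (if 2 * d - 1 ≤ ρ then 1 else 0),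
               normSign σ ((ϖ * σ ϖ) ^ ρ * eA) * normSign σ (1 + g) * (if 2 * d - 1 ≤ ρ then 1 else 0),
               normSign σ (-(1 + g)) * (normSign σ ((ϖ * σ ϖ) ^ ρ * eA) * normSign σ (1 + g))] : Fin 3 → ℤ) 0 : ℤ) : ℚ) / 2 * mass =
            ((normSign σ eA * normSign σ (-1 : K) : ℤ) : ℚ) / 2 * mass *
              (((![normSign σ (-(1 + g)), normSign σ g * normSign σ (-(1 + g)), normSign σ g] : Fin 3 → ℤ) 1 : ℤ) : ℚ) := by
        intro g hg
        simp only [cons_val_zero, cons_val_one, if_pos hal, mul_one, hωgα, hωneg g hg]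
        push_cast
        have h := hsq1 (-1 : K)
        have h' : (normSign σ (-1 : K) : ℚ) * (normSign σ (-1 : K) : ℚ) = 1 := by exact_mod_cast h
        linear_combination (-((normSign σ g : ℚ) * (normSign σ eA : ℚ) * (normSign σ (1 + g) : ℚ) / 2 * mass)) * h'
      rw [finsum_mem_congr rfl hterm, ← mul_finsum_mem, finsum_chiH_admissible_eq_zero hD h2 hal hRfin hR1 hR2 hR3 1, mul_zero]
      simp
    · have hterm : ∀ g ∈ {g : K | g ∈ R ∧ Valued.v (1 + g) = 1},
          (((![normSign σ g * (normSign σ ((ϖ * σ ϖ) ^ ρ * eA) * normSign σ (1 + g)) * (if 2 * d - 1 ≤ ρ then 1 else 0),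
               normSign σ ((ϖ * σ ϖ) ^ ρ * eA) * normSign σ (1 + g) * (if 2 * d - 1 ≤ ρ then 1 else 0),
               normSign σ (-(1 + g)) * (normSign σ ((ϖ * σ ϖ) ^ ρ * eA) * normSign σ (1 + g))] : Fin 3 → ℤ) 0 : ℤ) : ℚ) / 2 * mass = 0 := by
        intro g _
        simp only [cons_val_zero, if_neg hal, mul_zero, Int.cast_zero, zero_div, zero_mul]
      rw [finsum_mem_congr rfl hterm]
      simp
  · -- slot 1: `ι·ω(e_A)ω(−1)·Σ_g χ₀^H(g)·mass∕2 = 0`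
    simp only [Fin.mk_one]
    by_cases hal : 2 * d - 1 ≤ ρ
    · have hterm : ∀ g ∈ {g : K | g ∈ R ∧ Valued.v (1 + g) = 1},
          (((![normSign σ g * (normSign σ ((ϖ * σ ϖ) ^ ρ * eA) * normSign σ (1 + g)) * (if 2 * d - 1 ≤ ρ then 1 else 0),
               normSign σ ((ϖ * σ ϖ) ^ ρ * eA) * normSign σ (1 + g) * (if 2 * d - 1 ≤ ρ then 1 else 0),
               normSign σ (-(1 + g)) * (normSign σ ((ϖ * σ ϖ) ^ ρ * eA) * normSign σ (1 + g))] : Fin 3 → ℤ) 1 : ℤ) : ℚ) / 2 * mass =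
            ((normSign σ eA * normSign σ (-1 : K) : ℤ) : ℚ) / 2 * mass *
              (((![normSign σ (-(1 + g)), normSign σ g * normSign σ (-(1 + g)), normSign σ g] : Fin 3 → ℤ) 0 : ℤ) : ℚ) := by
        intro g hg
        simp only [cons_val_zero, cons_val_one, if_pos hal, mul_one, hωgα, hωneg g hg]
        push_cast
        have h := hsq1 (-1 : K)
        have h' : (normSign σ (-1 : K) : ℚ) * (normSign σ (-1 : K) : ℚ) = 1 := by exact_mod_cast h
        linear_combination (-((normSign σ eA : ℚ) * (normSign σ (1 + g) : ℚ) / 2 * mass)) * h'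
      rw [finsum_mem_congr rfl hterm, ← mul_finsum_mem, finsum_chiH_admissible_eq_zero hD h2 hal hRfin hR1 hR2 hR3 0, mul_zero]
      simp
    · have hterm : ∀ g ∈ {g : K | g ∈ R ∧ Valued.v (1 + g) = 1},
          (((![normSign σ g * (normSign σ ((ϖ * σ ϖ) ^ ρ * eA) * normSign σ (1 + g)) * (if 2 * d - 1 ≤ ρ then 1 else 0),
               normSign σ ((ϖ * σ ϖ) ^ ρ * eA) * normSign σ (1 + g) * (if 2 * d - 1 ≤ ρ then 1 else 0),
               normSign σ (-(1 + g)) * (normSign σ ((ϖ * σ ϖ) ^ ρ * eA) * normSign σ (1 + g))] : Fin 3 → ℤ) 1 : ℤ) : ℚ) / 2 * mass = 0 := by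
        intro g _
        simp only [cons_val_one, cons_val_zero, if_neg hal, mul_zero, Int.cast_zero, zero_div, zero_mul]
      rw [finsum_mem_congr rfl hterm]
      simp
  · -- slot 2: the CONSTANT `ω(−1)ω(e_A)∕2 · mass` summed over the `#R_adm` admissible classes
    simp only [Fin.reduceFinMk]
    have hterm : ∀ g ∈ {g : K | g ∈ R ∧ Valued.v (1 + g) = 1},
        (((![normSign σ g * (normSign σ ((ϖ * σ ϖ) ^ ρ * eA) * normSign σ (1 + g)) * (if 2 * d - 1 ≤ ρ then 1 else 0),
             normSign σ ((ϖ * σ ϖ) ^ ρ * eA) * normSign σ (1 + g) * (if 2 * d - 1 ≤ ρ then 1 else 0),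
             normSign σ (-(1 + g)) * (normSign σ ((ϖ * σ ϖ) ^ ρ * eA) * normSign σ (1 + g))] : Fin 3 → ℤ) 2 : ℤ) : ℚ) / 2 * mass =
          ((normSign σ (-1 : K) * normSign σ eA : ℤ) : ℚ) / 2 * mass := by
      intro g hg
      simp only [cons_val_two, tail_cons, head_cons, hωgα, hωneg g hg]
      push_cast
      have h' : (normSign σ (1 + g) : ℚ) * (normSign σ (1 + g) : ℚ) = 1 := by exact_mod_cast hsq1 (1 + g)
      linear_combination ((normSign σ (-1 : K) : ℚ) * (normSign σ eA : ℚ) / 2 * mass) * h'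
    rw [finsum_mem_eq_ncard_mul hRadmfin _ _ hterm]
    simp only [cons_val_two, tail_cons, head_cons]
    rw [← htube]
    push_cast
    ring

end Summit.HodgeConjecture.HodgeConjecture.Cruxes.H413.F0P3cDyRamLabelledOddCoreHangingDeepSum

end
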